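import Summits.CriticalPhenomena.PercolationContinuityZ3.Theorems.Transplant.SkelPhiParaFrameChangeFine
import HarnessLib

/-!
# N1 (the `{±1}` node), LEVEL 1, (C) column file (C-N6a): READING A RUN BOX INTO THE FINE CELL MAP — the converse direction of the frame change
# (`SkelPhiParaFrameChangeFine`): a vertex whose run-frame position `runX φ c₀ n h σ v` lies in the box `±(a, b)` about the run origin `c₀` has its
# FINE cell position `fineSkel φ t₀ A n h vα vβ c₀' c₁' s₀ s₁ D v` within `(k₀, k₁)` of that of `c₀`, as soon as `c₀'·|A|·(|m|·a + |vα|·B) ≤ k₀·(n·D)`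
# and `c₁'·|A|·B ≤ k₁·D` with `B := (n+|h|)·(b+1)` (hp-8's `coarse_containment_run`, one multiplier per axis; the floor read back by p1's
# `shearCoord_bounds_of_floor_bounds`); hence `WinIn (runX …) Ω (run box) ⊆ WinIn (fineSkel …) Ω (fine box)` — the vertex-level ROOMS `hreg₂`/`hlast₂` of
# `Skelφ.reachOblAtHN_of_chain₂` reduce to planar containments of fine boxes in the two-unit cells.

builds on p205010 (kernel theorem, internal audit signed; external expert review pending) — nothing in this file uses p205010; nothing here is a
claim about the open node `SamePDropOfSkeletonNeg`.
Lane `prim-bschramm`, seat `prim-bschramm-p5` (gen 8; (C) lineage); helper file (`--supports stmt-CriticalPhenomena-4575`).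
* `run_abs_bounds_of_mem_Icc` (`runX … v ∈ Icc (−(a,b)) (a,b)` ⇒ `|Δα| ≤ a`, `|Δβ′| ≤ (n+|h|)(b+1)`), **`fine_abs_sub_le_of_runX_mem_Icc`**,
  **`winIn_runX_subset_winIn_fine`**.
[cite: MartineauTassion2017, §4.1] [cite: KozmaNitzan2024, §4 Lemma 11 (p. 22), Lemma 12 (pp. 23–25)]
-/

noncomputable section

namespace Summit.CriticalPhenomena.PercolationContinuityZ3.Theorems.Transplant

namespace Skelφ

open Literature.Probability.Percolation Literature.Probability.LatticeModels SimpleGraph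
open TwoAxis.Para (coarse lam0 lam1 modulus)

variable {V : Type} {G : SimpleGraph V} {φ : V → Site 2}

/-- **Run box ⇒ raw bounds**: `runX φ c₀ n h σ v ∈ Icc (−(a,b)) (a,b)` (`σ = ±1`, `1 ≤ n`) gives `|Δα| ≤ a` and `|Δβ′| ≤ (n+|h|)·(b+1)` about `c₀`.
[folklore] -/
theorem run_abs_bounds_of_mem_Icc {n : ℕ} (hn : 1 ≤ n) (c₀ : V) (h : ℤ) {σ : ℤ} (hσ : σ = 1 ∨ σ = -1) {a b : ℤ} {v : V}
    (hv : runX φ c₀ n h σ v ∈ Finset.Icc (-(![a, b] : Site 2)) ![a, b]) :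
    |relCoord φ c₀ 0 v| ≤ a ∧ |shearCoord φ c₀ n h v| ≤ (shearUnit n h : ℤ) * (b + 1) := by
  rw [Finset.mem_Icc, Pi.le_def, Pi.le_def, Fin.forall_fin_two, Fin.forall_fin_two] at hv
  simp only [Pi.neg_apply, runX_zero, runX_one, Matrix.cons_val_zero, Matrix.cons_val_one] at hv
  obtain ⟨⟨h0l, h1l⟩, h0u, h1u⟩ := hv
  have hσabs : |σ| = 1 := by rcases hσ with rfl | rfl <;> norm_num
  have hsu : (0 : ℤ) < shearUnit n h := shearUnit_pos hn h
  obtain ⟨hb1, hb2⟩ := shearCoord_bounds_of_floor_bounds (φ := φ) hn c₀ h σ v h1l h1u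
  constructor
  · have : |σ * relCoord φ c₀ 0 v| ≤ a := abs_le.2 ⟨h0l, h0u⟩
    rwa [abs_mul, hσabs, one_mul] at this
  · have : |σ * shearCoord φ c₀ n h v| ≤ (shearUnit n h : ℤ) * (b + 1) := abs_le.2 ⟨by nlinarith, by nlinarith⟩
    rwa [abs_mul, hσabs, one_mul] at this

/-- **A run box read into the fine cell map**: with `B := (n+|h|)(b+1)`, `c₀'·|A|·(|m|·a + |vα|·B) ≤ k₀·(n·D)` and `c₁'·|A|·B ≤ k₁·D`, a vertex with
`runX φ c₀ n h σ v` in the run box `±(a,b)` has fine position within `(k₀, k₁)` of that of `c₀`. [cite: KozmaNitzan2024, §4 Lemma 11 (p. 22)] -/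
theorem fine_abs_sub_le_of_runX_mem_Icc (t₀ : V) {A : ℤ} {n : ℕ} (hn : 1 ≤ n) {h vα vβ c₀' c₁' s₀ s₁ D a b k₀ k₁ : ℤ} (hc₀ : 0 ≤ c₀') (hc₁ : 0 ≤ c₁')
    (hD : 0 < D) (hb : 0 ≤ b) (hk0 : c₀' * (|A| * (|modulus n h vα vβ| * a + |vα| * ((shearUnit n h : ℤ) * (b + 1)))) ≤ k₀ * ((n : ℤ) * D))
    (hk1 : c₁' * (|A| * ((shearUnit n h : ℤ) * (b + 1))) ≤ k₁ * D) (c₀ : V) {σ : ℤ} (hσ : σ = 1 ∨ σ = -1) {v : V}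
    (hv : runX φ c₀ n h σ v ∈ Finset.Icc (-(![a, b] : Site 2)) ![a, b]) :
    |fineSkel φ t₀ A n h vα vβ c₀' c₁' s₀ s₁ D v 0 - fineSkel φ t₀ A n h vα vβ c₀' c₁' s₀ s₁ D c₀ 0| ≤ k₀ ∧
      |fineSkel φ t₀ A n h vα vβ c₀' c₁' s₀ s₁ D v 1 - fineSkel φ t₀ A n h vα vβ c₀' c₁' s₀ s₁ D c₀ 1| ≤ k₁ := by
  obtain ⟨ha, hB⟩ := run_abs_bounds_of_mem_Icc hn c₀ h hσ hv
  have hn0 : 0 < n := hn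
  have e0 : ∀ w : V, fineSkel φ t₀ A n h vα vβ c₀' c₁' s₀ s₁ D w 0 = coarseSkel φ t₀ A n h vα vβ c₀' s₀ s₁ D w 0 := fun w => rfl
  have e1 : ∀ w : V, fineSkel φ t₀ A n h vα vβ c₀' c₁' s₀ s₁ D w 1 = coarseSkel φ t₀ A n h vα vβ c₁' s₀ s₁ D w 1 := fun w => rfl
  -- base-`t₀` differences are the `c₀`-relative run coordinates
  have hα' : |relCoord φ t₀ 0 v - relCoord φ t₀ 0 c₀| ≤ a := by
    have : relCoord φ t₀ 0 v - relCoord φ t₀ 0 c₀ = relCoord φ c₀ 0 v := by simp only [relCoord_apply]; ring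
    rw [this]; exact ha
  have hβ' : |shearCoord φ t₀ n h v - shearCoord φ t₀ n h c₀| ≤ (shearUnit n h : ℤ) * (b + 1) := by
    have : shearCoord φ t₀ n h v - shearCoord φ t₀ n h c₀ = shearCoord φ c₀ n h v := by simp only [shearCoord_apply]; ring
    rw [this]; exact hB
  constructor
  · -- coordinate 0 at multiplier `c₀'` (hp-8's coarse containment; the second multiplier slot is fed a trivially valid bound)
    rw [e0, e0]
    have hB0 : 0 ≤ (shearUnit n h : ℤ) * (b + 1) := by have := shearUnit_pos hn h; positivity
    have hk1' : c₀' * (|A| * ((shearUnit n h : ℤ) * (b + 1))) ≤ (c₀' * (|A| * ((shearUnit n h : ℤ) * (b + 1)))) * D := by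
      have h0 : 0 ≤ c₀' * (|A| * ((shearUnit n h : ℤ) * (b + 1))) := by positivity
      nlinarith
    exact (coarse_containment_run t₀ hn0 hc₀ hD hk0 hk1' hα' hβ').1
  · -- coordinate 1 at multiplier `c₁'` (p1-g11's symmetric reading)
    rw [e1, e1]
    exact abs_coarseSkel_one_sub_le A n h vα vβ hc₁ hD hk1 t₀ c₀ v hB

/-- **A RUN WINDOW LIES IN A FINE-CELL WINDOW** (the rooms of segment 2 of the (C) corridor): inside any habitat `Ω`, the window over the run box
`±(a,b)` of `runX φ c₀ n h σ` lies in the window over the fine box `ρ(c₀) ± (k₀, k₁)` of the fine cell map, under the two reading inequalities.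
[cite: KozmaNitzan2024, §4 Lemma 12 (pp. 23–25)] -/
theorem winIn_runX_subset_winIn_fine [DecidableEq V] (t₀ : V) {A : ℤ} {n : ℕ} (hn : 1 ≤ n) {h vα vβ c₀' c₁' s₀ s₁ D a b : ℤ} {k₀ k₁ : ℕ}
    (hc₀ : 0 ≤ c₀') (hc₁ : 0 ≤ c₁') (hD : 0 < D) (hb : 0 ≤ b)
    (hk0 : c₀' * (|A| * (|modulus n h vα vβ| * a + |vα| * ((shearUnit n h : ℤ) * (b + 1)))) ≤ (k₀ : ℤ) * ((n : ℤ) * D))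
    (hk1 : c₁' * (|A| * ((shearUnit n h : ℤ) * (b + 1))) ≤ (k₁ : ℤ) * D) (c₀ : V) {σ : ℤ} (hσ : σ = 1 ∨ σ = -1) (Ω : Finset V) :
    WinIn (runX φ c₀ n h σ) Ω (Finset.Icc (-(![a, b] : Site 2)) ![a, b]) ⊆
      WinIn (fineSkel φ t₀ A n h vα vβ c₀' c₁' s₀ s₁ D) Ω
        (Finset.Icc (fineSkel φ t₀ A n h vα vβ c₀' c₁' s₀ s₁ D c₀ - ![(k₀ : ℤ), k₁]) (fineSkel φ t₀ A n h vα vβ c₀' c₁' s₀ s₁ D c₀ + ![(k₀ : ℤ), k₁])) := by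
  intro g hg
  rw [mem_WinIn] at hg ⊢
  obtain ⟨hgΩ, hgr⟩ := hg
  obtain ⟨h0, h1⟩ := fine_abs_sub_le_of_runX_mem_Icc (s₀ := s₀) (s₁ := s₁) t₀ hn hc₀ hc₁ hD hb hk0 hk1 c₀ hσ hgr
  rw [abs_le] at h0 h1
  refine ⟨hgΩ, ?_⟩
  rw [Finset.mem_Icc, Pi.le_def, Pi.le_def, Fin.forall_fin_two, Fin.forall_fin_two]
  simp only [Pi.sub_apply, Pi.add_apply, Matrix.cons_val_zero, Matrix.cons_val_one]
  exact ⟨⟨by linarith, by linarith⟩, by linarith, by linarith⟩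

end Skelφ

end Summit.CriticalPhenomena.PercolationContinuityZ3.Theorems.Transplant

end
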